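import Literature.Barriers.HodgeConjecture.GeneralizedHodgeTrivialReasonsTorusForms
import HarnessLib

/-!
# The `(p,q)`-pieces of `Alt³_ℝ(E; ℂ)` in a threefold lattice frame adapted to a complex frame

Continuation of `GeneralizedHodgeTrivialReasonsTorusForms` (form-level Künneth bookkeeping
`transversalForm`, `mixedCupForm`, `dvForm`, `holForm`). Main results (module docstring there):
for a complex dual pair `(φ, v)` on `E` indexed by `Fin 3` and a frame `ε` with
`dz_a = ε a 0 + σ₁ ε a 1`, `dz̄_a = ε a 0 + σ₂ ε a 1`, `σ₁ ≠ σ₂`,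

* `typeSubmodule_three_zero_eq`, `typeSubmodule_zero_three_eq`, `typeSubmodule_two_one_eq`,
  `typeSubmodule_one_two_eq` — Lange–Birkenhake (1992), Thm. 1.1.21 (b) / Prop. 1.1.23 for `g = 3`,
  `n = 3`, written in the lattice frame exactly as the Hodge clauses of
  `exists_hodgeDecomposition_of_cupProducts` (`GeneralizedHodgeTrivialReasonsCupProducts`).

The finite combinatorial inputs — the words `tWord c`, `mWord ak b`, `allWord b` represent, up to
reordering, all injective words of length `3` over `Fin 3 × Bool` with the corresponding letter
counts — are settled by `decide`.

## References

* H. Lange, Ch. Birkenhake, *Complex Abelian Varieties* (1992), §1.1.5 Thm. 1.1.21, Prop. 1.1.23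
  (held copy, PDF pp. 24–26). [LangeBirkenhake1992]
-/

noncomputable section

open scoped ComplexConjugate
open Complex Function ContinuousAlternatingMap
open Literature.LinearAlgebra.Alternating Literature.Analysis.Complex

namespace Literature.Barriers.HodgeConjecture

/-! ### The representative words (pure combinatorics) -/

/-- The word `dz₀ dz₁ dz₂` with the letter at `c` conjugated (`b = true`: one `dz̄`, type `(2,1)`)
or all but `c` conjugated (`b = false`: one `dz`, type `(1,2)`): `tWord b c i = (i, (i = c) = b)`.
[cite: LangeBirkenhake1992, §1.1.5 Prop. 1.1.23] -/
def tWord (b : Bool) (c : Fin 3) : Fin 3 → Fin 3 × Bool :=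
  fun i ↦ (i, decide (i = c) == b)

/-- The factor-ordered word of the letters `dz_a, dz̄_a` and one letter `(d, b)` from the other factor
`d = a.succAbove k` (twin of `mixed`/`mixedCup`). [cite: LangeBirkenhake1992, §1.1.5 Prop. 1.1.23] -/
def mWord (b : Bool) (ak : Fin 3 × Fin 2) : Fin 3 → Fin 3 × Bool :=
  if (ak.2 : ℕ) < (ak.1 : ℕ) then ![(ak.1.succAbove ak.2, b), (ak.1, false), (ak.1, true)]
  else ![(ak.1, false), (ak.1, true), (ak.1.succAbove ak.2, b)]

/-- The constant-type word `i ↦ (i, b)` (`dz₀dz₁dz₂` or `dz̄₀dz̄₁dz̄₂`). [cite: LangeBirkenhake1992, §1.1.5 Prop. 1.1.23] -/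
def allWord (b : Bool) : Fin 3 → Fin 3 × Bool := fun i ↦ (i, b)

set_option maxRecDepth 16000 in
/-- The finite check behind `Λ^{3,0}`: every injective word with three letters `dz` is a reordering
of `dz₀dz₁dz₂`. [folklore] -/
theorem reps_three_zero_dec : ∀ w : Fin 3 → Fin 3 × Bool, Injective w → holCount w = 3 →
    barCount w = 0 → ∃ π : Equiv.Perm (Fin 3), allWord false = w ∘ π := by
  decide

set_option maxRecDepth 16000 in
/-- The finite check behind `Λ^{0,3}`. [folklore] -/
theorem reps_zero_three_dec : ∀ w : Fin 3 → Fin 3 × Bool, Injective w → holCount w = 0 →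
    barCount w = 3 → ∃ π : Equiv.Perm (Fin 3), allWord true = w ∘ π := by
  decide

set_option maxRecDepth 16000 in
/-- The finite check behind `Λ^{2,1}`: every injective word with two letters `dz` and one `dz̄` is a
reordering of a `tWord true c` or of an `mWord false ak`. [folklore] -/
theorem reps_two_one_dec : ∀ w : Fin 3 → Fin 3 × Bool, Injective w → holCount w = 2 →
    barCount w = 1 → ∃ r : Fin 3 → Fin 3 × Bool, ((∃ c, tWord true c = r) ∨ ∃ ak, mWord false ak = r) ∧
      ∃ π : Equiv.Perm (Fin 3), r = w ∘ π := by
  decide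

set_option maxRecDepth 16000 in
/-- The finite check behind `Λ^{1,2}`. [folklore] -/
theorem reps_one_two_dec : ∀ w : Fin 3 → Fin 3 × Bool, Injective w → holCount w = 1 →
    barCount w = 2 → ∃ r : Fin 3 → Fin 3 × Bool, ((∃ c, tWord false c = r) ∨ ∃ ak, mWord true ak = r) ∧
      ∃ π : Equiv.Perm (Fin 3), r = w ∘ π := by
  decide

/-- Letter counts of the representatives, `tWord`. [folklore] -/
theorem counts_tWord : ∀ (b : Bool) (c : Fin 3),
    holCount (tWord b c) = (if b then 2 else 1) ∧ barCount (tWord b c) = (if b then 1 else 2) := by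
  decide

/-- Letter counts of the representatives, `mWord`. [folklore] -/
theorem counts_mWord : ∀ (b : Bool) (ak : Fin 3 × Fin 2),
    holCount (mWord b ak) = (if b then 1 else 2) ∧ barCount (mWord b ak) = (if b then 2 else 1) := by
  decide

/-- Letter counts of the representatives, `allWord`. [folklore] -/
theorem counts_allWord : ∀ b : Bool,
    holCount (allWord b) = (if b then 0 else 3) ∧ barCount (allWord b) = (if b then 3 else 0) := by
  decide

/-- Every injective word of type `(3,0)` is a reordering of `dz₀dz₁dz₂` (set form). [folklore] -/
theorem reps_three_zero : ∀ w : Fin 3 → Fin 3 × Bool,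
    w ∈ {w : Fin 3 → Fin 3 × Bool | holCount w = 3 ∧ barCount w = 0} → Injective w →
      ∃ r ∈ ({allWord false} : Set (Fin 3 → Fin 3 × Bool)), ∃ π : Equiv.Perm (Fin 3), r = w ∘ π :=
  fun w hw hinj ↦ ⟨allWord false, rfl, reps_three_zero_dec w hinj hw.1 hw.2⟩

/-- Every injective word of type `(0,3)` is a reordering of `dz̄₀dz̄₁dz̄₂` (set form). [folklore] -/
theorem reps_zero_three : ∀ w : Fin 3 → Fin 3 × Bool,
    w ∈ {w : Fin 3 → Fin 3 × Bool | holCount w = 0 ∧ barCount w = 3} → Injective w →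
      ∃ r ∈ ({allWord true} : Set (Fin 3 → Fin 3 × Bool)), ∃ π : Equiv.Perm (Fin 3), r = w ∘ π :=
  fun w hw hinj ↦ ⟨allWord true, rfl, reps_zero_three_dec w hinj hw.1 hw.2⟩

/-- Every injective word of type `(2,1)` is a reordering of a `tWord true c` or an `mWord false ak`
(set form). [folklore] -/
theorem reps_two_one : ∀ w : Fin 3 → Fin 3 × Bool,
    w ∈ {w : Fin 3 → Fin 3 × Bool | holCount w = 2 ∧ barCount w = 1} → Injective w →
      ∃ r ∈ Set.range (tWord true) ∪ Set.range (mWord false),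
        ∃ π : Equiv.Perm (Fin 3), r = w ∘ π :=
  fun w hw hinj ↦ by
    obtain ⟨r, hr, π, h⟩ := reps_two_one_dec w hinj hw.1 hw.2
    exact ⟨r, hr, π, h⟩

/-- Every injective word of type `(1,2)` is a reordering of a `tWord false c` or an `mWord true ak`
(set form). [folklore] -/
theorem reps_one_two : ∀ w : Fin 3 → Fin 3 × Bool,
    w ∈ {w : Fin 3 → Fin 3 × Bool | holCount w = 1 ∧ barCount w = 2} → Injective w →
      ∃ r ∈ Set.range (tWord false) ∪ Set.range (mWord true),
        ∃ π : Equiv.Perm (Fin 3), r = w ∘ π :=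
  fun w hw hinj ↦ by
    obtain ⟨r, hr, π, h⟩ := reps_one_two_dec w hinj hw.1 hw.2
    exact ⟨r, hr, π, h⟩

/-- The representatives have the right counts, `(3,0)`. [folklore] -/
theorem reps_three_zero_subset :
    ({allWord false} : Set (Fin 3 → Fin 3 × Bool)) ⊆ {w | holCount w = 3 ∧ barCount w = 0} := by
  rintro _ rfl; exact counts_allWord false

/-- The representatives have the right counts, `(0,3)`. [folklore] -/
theorem reps_zero_three_subset :
    ({allWord true} : Set (Fin 3 → Fin 3 × Bool)) ⊆ {w | holCount w = 0 ∧ barCount w = 3} := by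
  rintro _ rfl; exact counts_allWord true

/-- The representatives have the right counts, `(2,1)`. [folklore] -/
theorem reps_two_one_subset :
    Set.range (tWord true) ∪ Set.range (mWord false) ⊆
      {w : Fin 3 → Fin 3 × Bool | holCount w = 2 ∧ barCount w = 1} := by
  rintro _ (⟨c, rfl⟩ | ⟨ak, rfl⟩)
  · exact counts_tWord true c
  · exact counts_mWord false ak

/-- The representatives have the right counts, `(1,2)`. [folklore] -/
theorem reps_one_two_subset :
    Set.range (tWord false) ∪ Set.range (mWord true) ⊆
      {w : Fin 3 → Fin 3 × Bool | holCount w = 1 ∧ barCount w = 2} := by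
  rintro _ (⟨c, rfl⟩ | ⟨ak, rfl⟩)
  · exact counts_tWord false c
  · exact counts_mWord true ak

/-! ### The monomials of the representative words in the lattice frame -/

variable {E : Type*} [NormedAddCommGroup E] [NormedSpace ℂ E]
  (φ : Fin 3 → (E →L[ℂ] ℂ)) (ε : Fin 3 → Fin 2 → (E →L[ℝ] ℂ)) {σ₁ σ₂ : ℂ}

/-- Length-three monomials are triple wedges of their letters. [folklore] -/
theorem wedgeWord_three (w : Fin 3 → Fin 3 × Bool) :
    wedgeWord (pqLetter φ) (oneForm₀ E) 3 w =
      wedgeThree (pqLetter φ (w 0)) (pqLetter φ (w 1)) (pqLetter φ (w 2)) := rfl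

section Adapted

variable (h0 : ∀ a, pqLetter φ (a, false) = dvForm ε σ₁ a) (h1 : ∀ a, pqLetter φ (a, true) = dvForm ε σ₂ a)
include h0 h1

/-- In an adapted frame the letter `(a, b)` is `dw_a` with `σ₁` (`b = false`) or `σ₂` (`b = true`).
[cite: LangeBirkenhake1992, §1.1.5 (proof of Thm. 1.1.21)] -/
theorem pqLetter_eq_dvForm (a : Fin 3) (b : Bool) :
    pqLetter φ (a, b) = dvForm ε (if b then σ₂ else σ₁) a := by
  cases b
  · exact h0 a
  · exact h1 a

/-- `tWord b c` spells `dw₀ ∧ dw₁ ∧ dw₂` with the entry at `c` of the other kind.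
[cite: LangeBirkenhake1992, §1.1.5 Prop. 1.1.23] -/
theorem wedgeWord_tWord (b : Bool) (c : Fin 3) :
    wedgeWord (pqLetter φ) (oneForm₀ E) 3 (tWord b c) =
      holForm ε (Function.update (fun _ ↦ if b then σ₁ else σ₂) c (if b then σ₂ else σ₁)) := by
  rw [wedgeWord_three, holForm]
  have hl : ∀ i : Fin 3, pqLetter φ (tWord b c i) =
      dvForm ε (Function.update (fun _ ↦ if b then σ₁ else σ₂) c (if b then σ₂ else σ₁) i) i := by
    intro i
    rw [tWord, pqLetter_eq_dvForm φ ε h0 h1]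
    by_cases hi : i = c
    · subst hi; cases b <;> simp
    · cases b <;> simp [hi]
  rw [hl 0, hl 1, hl 2]

/-- `mWord b ak` spells, up to the unit `σ₂ - σ₁`, the factor-ordered mixed form with the entry
`dw_d` (`σ₁` for `b = false`, `σ₂` for `b = true`) from the other factor `d = a.succAbove k`.
[cite: LangeBirkenhake1992, §1.1.5 Prop. 1.1.23] -/
theorem wedgeWord_mWord (b : Bool) (ak : Fin 3 × Fin 2) :
    wedgeWord (pqLetter φ) (oneForm₀ E) 3 (mWord b ak) =
      (σ₂ - σ₁) • mixedCupForm ε ak.1 ak.2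
        (dvForm ε (if b then σ₂ else σ₁) (ak.1.succAbove ak.2)) := by
  unfold mixedCupForm mWord
  by_cases hlt : (ak.2 : ℕ) < (ak.1 : ℕ)
  · rw [if_pos hlt, if_pos hlt]
    change wedgeThree (pqLetter φ (ak.1.succAbove ak.2, b)) (pqLetter φ (ak.1, false))
      (pqLetter φ (ak.1, true)) = _
    rw [pqLetter_eq_dvForm φ ε h0 h1, h0, h1, wedgeThree_dvForm_dvForm_right]
  · rw [if_neg hlt, if_neg hlt]
    change wedgeThree (pqLetter φ (ak.1, false)) (pqLetter φ (ak.1, true))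
      (pqLetter φ (ak.1.succAbove ak.2, b)) = _
    rw [h0, h1, pqLetter_eq_dvForm φ ε h0 h1, wedgeThree_dvForm_dvForm_left]

/-- `allWord b` spells `dw₀ ∧ dw₁ ∧ dw₂` of constant kind. [cite: LangeBirkenhake1992, §1.1.5 Prop. 1.1.23] -/
theorem wedgeWord_allWord (b : Bool) :
    wedgeWord (pqLetter φ) (oneForm₀ E) 3 (allWord b) = holForm ε (fun _ ↦ if b then σ₂ else σ₁) := by
  rw [wedgeWord_three, holForm]
  simp only [allWord, pqLetter_eq_dvForm φ ε h0 h1]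

/-! ### The `(p,q)`-pieces -/

variable {v : Fin 3 → E} (hφv : ∑ j, (φ j).smulRight (v j) = ContinuousLinearMap.id ℂ E)
  (hσ : σ₁ ≠ σ₂)
include hφv

/-- **`Λ^{3,0} = ℂ · dz₀ ∧ dz₁ ∧ dz₂ = ℂ · holForm ε (σ₁,σ₁,σ₁)`.**
[cite: LangeBirkenhake1992, §1.1.5 Thm. 1.1.21 (b) and Prop. 1.1.23] -/
theorem typeSubmodule_three_zero_eq :
    typeSubmodule E 3 3 0 = ℂ ∙ holForm ε (fun _ ↦ σ₁) := by
  rw [typeSubmodule_eq_span_pqWord φ hφv 3 3 0,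
    show pqWord φ 3 = wedgeWord (pqLetter φ) (oneForm₀ E) 3 from rfl,
    span_wedgeWord_image_eq_of_representatives (pqLetter φ) (oneForm₀ E) reps_three_zero_subset
      reps_three_zero,
    Set.image_singleton, wedgeWord_allWord φ ε h0 h1]
  rfl

/-- **`Λ^{0,3} = ℂ · dz̄₀ ∧ dz̄₁ ∧ dz̄₂ = ℂ · holForm ε (σ₂,σ₂,σ₂)`.**
[cite: LangeBirkenhake1992, §1.1.5 Thm. 1.1.21 (b) and Prop. 1.1.23] -/
theorem typeSubmodule_zero_three_eq :
    typeSubmodule E 3 0 3 = ℂ ∙ holForm ε (fun _ ↦ σ₂) := by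
  rw [typeSubmodule_eq_span_pqWord φ hφv 3 0 3,
    show pqWord φ 3 = wedgeWord (pqLetter φ) (oneForm₀ E) 3 from rfl,
    span_wedgeWord_image_eq_of_representatives (pqLetter φ) (oneForm₀ E) reps_zero_three_subset
      reps_zero_three,
    Set.image_singleton, wedgeWord_allWord φ ε h0 h1]
  rfl

include hσ

/-- **`Λ^{2,1}` is spanned by the three `dw₀ ∧ dw₁ ∧ dw₂` with exactly one entry `dz̄` and the six
factor-ordered `ε_{a,0} ∧ ε_{a,1} ∧ dz_d`** (`= dz_a ∧ dz̄_a ∧ dz_d / (σ₂ - σ₁)`).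
[cite: LangeBirkenhake1992, §1.1.5 Thm. 1.1.21 (b) and Prop. 1.1.23] -/
theorem typeSubmodule_two_one_eq :
    typeSubmodule E 3 2 1 = Submodule.span ℂ
      (Set.range (fun c : Fin 3 ↦ holForm ε (Function.update (fun _ ↦ σ₁) c σ₂)) ∪
        Set.range (fun ak : Fin 3 × Fin 2 ↦
          mixedCupForm ε ak.1 ak.2 (dvForm ε σ₁ (ak.1.succAbove ak.2)))) := by
  rw [typeSubmodule_eq_span_pqWord φ hφv 3 2 1,
    show pqWord φ 3 = wedgeWord (pqLetter φ) (oneForm₀ E) 3 from rfl,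
    span_wedgeWord_image_eq_of_representatives (pqLetter φ) (oneForm₀ E) reps_two_one_subset
      reps_two_one]
  have hunit : (σ₂ - σ₁)⁻¹ * (σ₂ - σ₁) = 1 := inv_mul_cancel₀ (sub_ne_zero.2 hσ.symm)
  refine le_antisymm (Submodule.span_le.2 ?_) (Submodule.span_le.2 ?_)
  · rintro _ ⟨r, hr, rfl⟩
    rcases hr with ⟨c, rfl⟩ | ⟨ak, rfl⟩
    · rw [wedgeWord_tWord φ ε h0 h1]
      exact Submodule.subset_span (Or.inl ⟨c, by simp⟩)
    · rw [wedgeWord_mWord φ ε h0 h1]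
      exact Submodule.smul_mem _ _ (Submodule.subset_span (Or.inr ⟨ak, by simp⟩))
  · rintro _ (⟨c, rfl⟩ | ⟨ak, rfl⟩)
    · have h := wedgeWord_tWord φ ε h0 h1 true c
      simp only [↓reduceIte] at h
      change holForm ε (Function.update (fun _ ↦ σ₁) c σ₂) ∈ _
      rw [← h]
      exact Submodule.subset_span ⟨tWord true c, Or.inl ⟨c, rfl⟩, rfl⟩
    · have h := wedgeWord_mWord φ ε h0 h1 false ak
      simp only [Bool.false_eq_true, ↓reduceIte] at h
      have h' : mixedCupForm ε ak.1 ak.2 (dvForm ε σ₁ (ak.1.succAbove ak.2)) =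
          (σ₂ - σ₁)⁻¹ • wedgeWord (pqLetter φ) (oneForm₀ E) 3 (mWord false ak) := by
        rw [h, smul_smul, hunit, one_smul]
      change mixedCupForm ε ak.1 ak.2 (dvForm ε σ₁ (ak.1.succAbove ak.2)) ∈ _
      rw [h']
      exact Submodule.smul_mem _ _ (Submodule.subset_span ⟨mWord false ak, Or.inr ⟨ak, rfl⟩, rfl⟩)

/-- **`Λ^{1,2}` symmetrically**: the three `dw₀ ∧ dw₁ ∧ dw₂` with exactly one entry `dz` and the six
factor-ordered `ε_{a,0} ∧ ε_{a,1} ∧ dz̄_d`. [cite: LangeBirkenhake1992, §1.1.5 Thm. 1.1.21 (b) and Prop. 1.1.23] -/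
theorem typeSubmodule_one_two_eq :
    typeSubmodule E 3 1 2 = Submodule.span ℂ
      (Set.range (fun c : Fin 3 ↦ holForm ε (Function.update (fun _ ↦ σ₂) c σ₁)) ∪
        Set.range (fun ak : Fin 3 × Fin 2 ↦
          mixedCupForm ε ak.1 ak.2 (dvForm ε σ₂ (ak.1.succAbove ak.2)))) := by
  rw [typeSubmodule_eq_span_pqWord φ hφv 3 1 2,
    show pqWord φ 3 = wedgeWord (pqLetter φ) (oneForm₀ E) 3 from rfl,
    span_wedgeWord_image_eq_of_representatives (pqLetter φ) (oneForm₀ E) reps_one_two_subset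
      reps_one_two]
  have hunit : (σ₂ - σ₁)⁻¹ * (σ₂ - σ₁) = 1 := inv_mul_cancel₀ (sub_ne_zero.2 hσ.symm)
  refine le_antisymm (Submodule.span_le.2 ?_) (Submodule.span_le.2 ?_)
  · rintro _ ⟨r, hr, rfl⟩
    rcases hr with ⟨c, rfl⟩ | ⟨ak, rfl⟩
    · rw [wedgeWord_tWord φ ε h0 h1]
      exact Submodule.subset_span (Or.inl ⟨c, by simp⟩)
    · rw [wedgeWord_mWord φ ε h0 h1]
      exact Submodule.smul_mem _ _ (Submodule.subset_span (Or.inr ⟨ak, by simp⟩))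
  · rintro _ (⟨c, rfl⟩ | ⟨ak, rfl⟩)
    · have h := wedgeWord_tWord φ ε h0 h1 false c
      simp only [Bool.false_eq_true, ↓reduceIte] at h
      change holForm ε (Function.update (fun _ ↦ σ₂) c σ₁) ∈ _
      rw [← h]
      exact Submodule.subset_span ⟨tWord false c, Or.inl ⟨c, rfl⟩, rfl⟩
    · have h := wedgeWord_mWord φ ε h0 h1 true ak
      simp only [↓reduceIte] at h
      have h' : mixedCupForm ε ak.1 ak.2 (dvForm ε σ₂ (ak.1.succAbove ak.2)) =
          (σ₂ - σ₁)⁻¹ • wedgeWord (pqLetter φ) (oneForm₀ E) 3 (mWord true ak) := by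
        rw [h, smul_smul, hunit, one_smul]
      change mixedCupForm ε ak.1 ak.2 (dvForm ε σ₂ (ak.1.succAbove ak.2)) ∈ _
      rw [h']
      exact Submodule.smul_mem _ _ (Submodule.subset_span ⟨mWord true ak, Or.inr ⟨ak, rfl⟩, rfl⟩)

end Adapted

end Literature.Barriers.HodgeConjecture

end
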